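import Summits.BirchSwinnertonDyer.BirchSwinnertonDyer.Theorems.PrintCFramBottomClassIndexLawFiveLeFlipRungTwoThetaFactor
import Summits.BirchSwinnertonDyer.BirchSwinnertonDyer.Theorems.PrintCFramBottomClassIndexLawFiveLeFlipRungTwoThetaUnit
import Summits.BirchSwinnertonDyer.BirchSwinnertonDyer.Theorems.PrintCFramBottomClassIndexLawFiveLeFlipRungTwoJunk
import Summits.BirchSwinnertonDyer.BirchSwinnertonDyer.Theorems.PrintCFramBottomClassIndexLawFiveLeHalfIntegralBridge
import Summits.BirchSwinnertonDyer.BirchSwinnertonDyer.Theorems.PrintCFramBottomClassIndexLawFiveLeCuspSeedQExpansionPrincipleAtZero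
import Literature.NumberTheory.EllipticCurves.TunnellFormsAutomorphy
import HarnessLib

set_option autoImplicit false

/-!
# Crux `PrintCFram.BottomClassIndexLawFiveLe` (stmt-BirchSwinnertonDyer-20372), line `eisenstein-resource-bdp-line` (registry v29):
# T6 «THE 2-ADIC FLIPPED-CUSP RUNG», piece P4c — THE Θ-SIDE HYPOTHESES OF THE NF-Q TRANSPORT, DISCHARGED
# (cell `bsd-print-cfram`, width seat `bsd-line-cfram-p1-w5` g8; THEOREMS ONLY, `--supports` 20372; BSD is not proved by any of this)

HONEST FRAMING. Analysis of ONE explicit function on `ℍ`, `Θ(z) := θ(γ₀•z)·(√((Mz+64)/8))⁻¹` (`γ₀ = [a b; M 64] ∈ SL₂(ℤ)`, `M` odd),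
the θ-factor of the Katz vehicle at the 2-adic flipped cusp (P4b `slash_flippedCusp_eq_theta_mul_bracket`: `V ∣ γ₀ = Θ·B`); nothing
here is a statement about elliptic curves, Bernoulli numbers or BSD; no registered stub is closed. The NF-Q transport
`exists_isIntegral_qExpansion_coeff_of_slash_eq_mul` (w3 g19) asks of `Θ`: (hΘ) `AnalyticAt ℂ (cuspFunction N Θ) 0`, (hΘint) every coefficient
of `qExpansion N Θ` in `ℤ̄[1/N]`, (hΘ0) the constant coefficient a unit of `ℤ̄[1/N]`. Here, for `16 ∣ N`, `M ∣ N`: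
* §1 `Θ` IS `16`-PERIODIC (my P3 `junkTranslate_periodic_of_ratio` at `g = θ ∈ M_{1/2}(4)`, `j₁ = 0`), HOLOMORPHIC (`√((Mz+64)/8) =
  j(·;M,64)(z)/√8` up to the unit symbol, the tree's `mdifferentiable_thetaFactor`) and BOUNDED at `i∞` (`‖Θ‖² = 8‖slashSq 1 θ γ₀‖`, θ's cusp
  condition) ⟹ (hΘ) and Mathlib's `hasSum_qExpansion`;
* §2 THE EXPLICIT SERIES: from P4b `shimuraTheta_flippedCusp_mul_inv_csqrt`, `Θ(z) = Σ_K T(K)·𝕢_N(z)^K` with `T` supported on `K = (N/4)·k²`,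
  `T((N/4)k²) = (√(iM/4))⁻¹·(2 − [k=0])·e(16k²/M)·G(a,k;M)` (`G(a,−k;M) = G(a,k;M)`; regrouping `ℤ → ℕ` by `HasSum.nat_add_neg`/`update`/`extend`);
* §3 uniqueness of `q`-expansion coefficients ⟹ **`theta_transport_hypotheses`**: (hΘ) ∧ (hΘint) ∧ (hΘ0) (constant term
  `(√(iM/4))⁻¹·G(a;M)`, a unit by P4a `exists_inverse_quadGaussSum_of_det` and P4b `csqrt_I_mul_div_four_inv_mem`).
beyond-print theorem: NO.

References: [Shimura1973HalfIntegral] §1; [KoblitzECMF1993] IV §1; [DiamondShurman2005] §1.1; crux notes w7g8-T6 v4 §5d (P4).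
-/

-- summit-side namespace `Summit.BirchSwinnertonDyer.BirchSwinnertonDyer.…` (single-conjunct summit, D-0017 layout)
set_option linter.dupNamespace false

noncomputable section

open scoped MatrixGroups ModularForm Real Classical Topology Manifold NumberTheorySymbols
open UpperHalfPlane hiding I
open Complex CongruenceSubgroup Function Filter
open Literature.NumberTheory.EllipticCurves.ModularForms
open Literature.NumberTheory.EllipticCurves.Tunnell1983 (thetaMul thetaMul_one_eq_shimuraTheta)

namespace Summit.BirchSwinnertonDyer.BirchSwinnertonDyer.Theorems.PrintCFram.FlipRung

open Summit.BirchSwinnertonDyer.BirchSwinnertonDyer.Theorems.PrintCFram.HalfIntegralBridge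

/-! ## §1 `Θ` is periodic, holomorphic and bounded at `i∞` -/

/-- `θ ∈ M_{1/2}(4, 1)` (the tree's `thetaMul_sq_mem_halfIntModularForms` at `Q = 1`, `thetaMul 1 = θ`). [cite: Shimura1973HalfIntegral, §1] -/
theorem shimuraTheta_mem_halfIntModularForms : shimuraTheta ∈ halfIntModularForms 1 4 1 := by
  have h := thetaMul_sq_mem_halfIntModularForms (Q := 1) one_pos
  have e : thetaMul 1 = shimuraTheta := funext fun z ↦ thetaMul_one_eq_shimuraTheta z
  rw [one_pow, mul_one, e] at h
  exact h

/-- **`Θ` is `16`-periodic:** `θ(γ₀•(z+16))·(√((M(z+16)+64)/8))⁻¹ = θ(γ₀•z)·(√((Mz+64)/8))⁻¹` (P3's conjugation `γ₀T¹⁶γ₀⁻¹ ∈ Γ₀(4)` with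
trivial multiplier, at `g = θ`). [cite: Shimura1973HalfIntegral, §1] -/
theorem thetaCusp_periodic_sixteen (γ₀ : SL(2, ℤ)) {M : ℕ} (hM : (γ₀ 1 0 : ℤ) = M) (h64 : (γ₀ 1 1 : ℤ) = 64) (hM0 : M ≠ 0) (z : ℍ) :
    shimuraTheta (γ₀ • ((16 : ℝ) +ᵥ z)) * (Complex.sqrt (((M : ℂ) * ((((16 : ℝ) +ᵥ z : ℍ)) : ℂ) + 64) / 8))⁻¹ =
      shimuraTheta (γ₀ • z) * (Complex.sqrt (((M : ℂ) * z + 64) / 8))⁻¹ := by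
  have hMpos : 0 < M := Nat.pos_of_ne_zero hM0
  have hX : 0 < (((M : ℂ) * z + 64) / 8).im := by
    rw [show ((M : ℂ) * z + 64) / 8 = ((M : ℂ) * z + 64) / ((8 : ℝ) : ℂ) by norm_num, Complex.div_ofReal_im]
    exact div_pos (im_level_mul_add_sixtyfour_pos hMpos z) (by norm_num)
  have hY : 0 < (((M : ℂ) * ((z : ℂ) + 16) + 64) / 8).im := by
    rw [show ((M : ℂ) * ((z : ℂ) + 16) + 64) / 8 = ((M : ℂ) * ((z : ℂ) + 16) + 64) / ((8 : ℝ) : ℂ) by norm_num,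
      Complex.div_ofReal_im]
    have : ((M : ℂ) * ((z : ℂ) + 16) + 64).im = (M : ℝ) * z.im := by simp
    rw [this]; exact div_pos (mul_pos (by exact_mod_cast hMpos) z.im_pos) (by norm_num)
  have h := junkTranslate_periodic_of_ratio (κ := 1) (ψ := (1 : DirichletCharacter ℂ 4)) (dvd_refl 4)
    shimuraTheta_mem_halfIntModularForms γ₀ (M := (M : ℤ)) hM h64 (by exact_mod_cast hM0)
    ⟨4 * (M : ℤ) ^ 2, by ring⟩ 0 ⟨(M : ℤ) * (4 * γ₀ 0 0), by ring⟩ z hX hY (by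
      have hX0 : ((M : ℂ) * z + 64) ≠ 0 := by
        intro h0; have := im_level_mul_add_sixtyfour_pos hMpos z; rw [h0] at this; simp at this
      push_cast
      field_simp)
  simp only [Int.cast_zero, zero_div, zero_vadd, pow_one] at h
  have h16 : ((((16 : ℝ) +ᵥ z : ℍ)) : ℂ) = (z : ℂ) + 16 := by rw [coe_vadd]; push_cast; ring
  rw [h16]
  exact h

/-- `Θ` composed with `ofComplex` is `16`-periodic on `ℂ` (the shape Mathlib's `qExpansion` API wants). [folklore] -/
theorem thetaCusp_periodic_comp_ofComplex (γ₀ : SL(2, ℤ)) {M : ℕ} (hM : (γ₀ 1 0 : ℤ) = M) (h64 : (γ₀ 1 1 : ℤ) = 64) (hM0 : M ≠ 0) :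
    Periodic ((fun z : ℍ ↦ shimuraTheta (γ₀ • z) * (Complex.sqrt (((M : ℂ) * z + 64) / 8))⁻¹) ∘ ofComplex) (16 : ℝ) := by
  intro w
  by_cases hw : 0 < w.im
  · have h1w : 0 < (w + (16 : ℝ)).im := by simpa using hw
    simp only [Function.comp_apply]
    rw [ofComplex_apply_of_im_pos h1w, ofComplex_apply_of_im_pos hw]
    have e : (⟨w + (16 : ℝ), h1w⟩ : ℍ) = (16 : ℝ) +ᵥ ⟨w, hw⟩ := by
      ext; simp [coe_vadd, add_comm]
    rw [e]
    exact thetaCusp_periodic_sixteen γ₀ hM h64 hM0 ⟨w, hw⟩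
  · simp only [Function.comp_apply]
    rw [ofComplex_apply_eq_of_im_nonpos (by simpa using not_lt.mp hw) (not_lt.mp hw)]

/-- `Θ` composed with `ofComplex` is `N`-periodic for `16 ∣ N`. [folklore] -/
theorem thetaCusp_periodic_comp_ofComplex_of_dvd (γ₀ : SL(2, ℤ)) {M : ℕ} (hM : (γ₀ 1 0 : ℤ) = M) (h64 : (γ₀ 1 1 : ℤ) = 64)
    (hM0 : M ≠ 0) {N : ℕ} (hN : 16 ∣ N) :
    Periodic ((fun z : ℍ ↦ shimuraTheta (γ₀ • z) * (Complex.sqrt (((M : ℂ) * z + 64) / 8))⁻¹) ∘ ofComplex) (N : ℝ) := by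
  obtain ⟨n, rfl⟩ := hN
  have h := (thetaCusp_periodic_comp_ofComplex γ₀ hM h64 hM0).nat_mul n
  push_cast
  rw [mul_comm] at h
  exact h

/-- `√(X/8) = √X/√8` for `X ∈ ℍ` (principal branch; both lie in the open right half-plane region of uniqueness). [folklore] -/
theorem csqrt_div_eight_eq {X : ℂ} (hX : 0 < X.im) :
    Complex.sqrt (X / 8) = Complex.sqrt X * ((Real.sqrt 8 : ℝ) : ℂ)⁻¹ := by
  have h8 : ((Real.sqrt 8 : ℝ) : ℂ) ^ 2 = 8 := by
    rw [← Complex.ofReal_pow, Real.sq_sqrt (by norm_num)]; norm_num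
  have h8ne : ((Real.sqrt 8 : ℝ) : ℂ) ≠ 0 := by
    intro h; rw [h] at h8; norm_num at h8
  have hq := csqrt_mem_quadrant hX
  refine csqrt_eq_of_sq_eq' ?_ (Or.inl ?_)
  · rw [mul_pow, inv_pow, csqrt_sq, h8]; ring
  · rw [← Complex.ofReal_inv]
    simp only [Complex.mul_re, Complex.ofReal_re, Complex.ofReal_im, mul_zero, sub_zero]
    exact mul_pos hq.1 (inv_pos.mpr (Real.sqrt_pos.mpr (by norm_num)))

/-- `√((Mz+64)/8) = j(·; M, 64)(z)/√8` for odd `M`: the base of P1 is Shimura's `thetaFactor M 64` (`ε_64 = 1`, `(M/64) = (M/2)⁶ = 1`)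
over `√8`. [cite: Shimura1973HalfIntegral, §1] -/
theorem csqrt_level_div_eight_eq_thetaFactor {M : ℕ} (hM : Odd M) (z : ℍ) :
    Complex.sqrt (((M : ℂ) * z + 64) / 8) = thetaFactor M 64 z * ((Real.sqrt 8 : ℝ) : ℂ)⁻¹ := by
  have hMpos : 0 < M := hM.pos
  rw [csqrt_div_eight_eq (im_level_mul_add_sixtyfour_pos hMpos z)]
  congr 1
  unfold thetaFactor
  have hε : thetaEps 64 = 1 := by unfold thetaEps; norm_num
  have hσ : shimuraSymbol M 64 = 1 := by
    have hcop : Nat.Coprime M 2 :=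
      ((Nat.Prime.coprime_iff_not_dvd Nat.prime_two).mpr (by obtain ⟨m, hm⟩ := hM; omega)).symm
    have hg : ((M : ℤ)).gcd 2 = 1 := by rw [Int.gcd_eq_natAbs]; simpa using hcop.gcd_eq_one
    have hJ : J((M : ℤ) | 64) = 1 := by
      rw [show (64 : ℕ) = 2 ^ (2 * 3) by norm_num, jacobiSym.pow_right, pow_mul, jacobiSym.sq_one hg, one_pow]
    unfold shimuraSymbol
    norm_num [hJ]
  rw [hε, hσ]
  push_cast
  ring

/-- **`Θ` is holomorphic on `ℍ`.** [folklore] -/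
theorem mdifferentiable_thetaCusp (γ₀ : SL(2, ℤ)) {M : ℕ} (hModd : Odd M) :
    MDifferentiable 𝓘(ℂ) 𝓘(ℂ) (fun z : ℍ ↦ shimuraTheta (γ₀ • z) * (Complex.sqrt (((M : ℂ) * z + 64) / 8))⁻¹) := by
  have h1 := mdifferentiable_comp_smul mdifferentiable_shimuraTheta γ₀
  have hgcd : Int.gcd M 64 = 1 := by
    obtain ⟨m, hm⟩ := hModd
    have hc : IsCoprime (M : ℤ) (2 ^ 6) := IsCoprime.pow_right ⟨1, -(m : ℤ), by rw [hm]; push_cast; ring⟩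
    have := Int.isCoprime_iff_gcd_eq_one.mp hc
    norm_num at this
    exact this
  have h2 : MDifferentiable 𝓘(ℂ) 𝓘(ℂ) (fun z : ℍ ↦ (Complex.sqrt (((M : ℂ) * z + 64) / 8))⁻¹) := by
    have e : (fun z : ℍ ↦ (Complex.sqrt (((M : ℂ) * z + 64) / 8))⁻¹) =
        fun z : ℍ ↦ (thetaFactor M 64 z)⁻¹ * ((Real.sqrt 8 : ℝ) : ℂ) := by
      funext z; rw [csqrt_level_div_eight_eq_thetaFactor hModd, mul_inv, inv_inv]
    rw [e]
    refine MDifferentiable.mul ?_ mdifferentiable_const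
    have hθ := mdifferentiable_thetaFactor (M : ℤ) 64
    rw [UpperHalfPlane.mdifferentiable_iff] at hθ ⊢
    refine (hθ.inv fun w hw ↦ ?_).congr fun w hw ↦ by simp [Function.comp_apply]
    simp only [Function.comp_apply]
    exact thetaFactor_ne_zero hgcd _
  exact h1.mul h2

/-- **`Θ` is bounded at `i∞`:** `‖Θ(z)‖² = 8·‖slashSq 1 θ γ₀ z‖`, and `θ ∈ M_{1/2}(4)` satisfies the cusp condition at `γ₀`. [folklore] -/
theorem isBoundedAtImInfty_thetaCusp (γ₀ : SL(2, ℤ)) {M : ℕ} (hM : (γ₀ 1 0 : ℤ) = M) (h64 : (γ₀ 1 1 : ℤ) = 64) (hM0 : M ≠ 0) :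
    IsBoundedAtImInfty (fun z : ℍ ↦ shimuraTheta (γ₀ • z) * (Complex.sqrt (((M : ℂ) * z + 64) / 8))⁻¹) := by
  have h := shimuraTheta_mem_halfIntModularForms.2.2 γ₀
  rw [isBoundedAtImInfty_iff] at h ⊢
  obtain ⟨B, A, hB⟩ := h
  refine ⟨Real.sqrt (8 * B), A, fun z hz ↦ ?_⟩
  have hMpos : 0 < M := Nat.pos_of_ne_zero hM0
  have hden : denom γ₀ z = (M : ℂ) * z + 64 := by rw [ModularGroup.denom_apply, hM, h64]; push_cast; ring
  have hX0 : (M : ℂ) * z + 64 ≠ 0 := by rw [← hden]; exact denom_ne_zero γ₀ z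
  have hslash : ‖slashSq 1 shimuraTheta γ₀ z‖ = ‖shimuraTheta (γ₀ • z)‖ ^ 2 / ‖(M : ℂ) * z + 64‖ := by
    rw [norm_slashSq, pow_one, hden]
  have hn : ‖Complex.sqrt (((M : ℂ) * z + 64) / 8)‖ ^ 2 = ‖(M : ℂ) * z + 64‖ / 8 := by
    rw [← norm_pow, csqrt_sq, norm_div]
    norm_num
  have hX8 : ‖(M : ℂ) * z + 64‖ ≠ 0 := norm_ne_zero_iff.mpr hX0
  have hsq : ‖shimuraTheta (γ₀ • z) * (Complex.sqrt (((M : ℂ) * z + 64) / 8))⁻¹‖ ^ 2 =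
      8 * ‖slashSq 1 shimuraTheta γ₀ z‖ := by
    rw [norm_mul, mul_pow, norm_inv, inv_pow, hn, hslash]
    field_simp
  have hle : ‖shimuraTheta (γ₀ • z) * (Complex.sqrt (((M : ℂ) * z + 64) / 8))⁻¹‖ ^ 2 ≤ 8 * B := by
    rw [hsq]; exact mul_le_mul_of_nonneg_left (hB z hz) (by norm_num)
  calc ‖shimuraTheta (γ₀ • z) * (Complex.sqrt (((M : ℂ) * z + 64) / 8))⁻¹‖
      = Real.sqrt (‖shimuraTheta (γ₀ • z) * (Complex.sqrt (((M : ℂ) * z + 64) / 8))⁻¹‖ ^ 2) :=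
        (Real.sqrt_sq (norm_nonneg _)).symm
    _ ≤ Real.sqrt (8 * B) := Real.sqrt_le_sqrt hle

/-- **(hΘ) `AnalyticAt ℂ (cuspFunction N Θ) 0`** for `16 ∣ N`, `N ≥ 1`, and Mathlib's `HasSum` of `qExpansion N Θ`. [cite: DiamondShurman2005, §1.1] -/
theorem thetaCusp_analytic_and_hasSum (γ₀ : SL(2, ℤ)) {M : ℕ} (hM : (γ₀ 1 0 : ℤ) = M) (h64 : (γ₀ 1 1 : ℤ) = 64) (hModd : Odd M)
    {N : ℕ} (hN : 16 ∣ N) (hN0 : 0 < N) :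
    AnalyticAt ℂ (cuspFunction N (fun z : ℍ ↦ shimuraTheta (γ₀ • z) * (Complex.sqrt (((M : ℂ) * z + 64) / 8))⁻¹)) 0 ∧
    ∀ τ : ℍ, HasSum (fun m : ℕ ↦ (qExpansion N (fun z : ℍ ↦ shimuraTheta (γ₀ • z) * (Complex.sqrt (((M : ℂ) * z + 64) / 8))⁻¹)).coeff m •
        Periodic.qParam N (τ : ℂ) ^ m) (shimuraTheta (γ₀ • τ) * (Complex.sqrt (((M : ℂ) * τ + 64) / 8))⁻¹) := by
  have hM0 : M ≠ 0 := hModd.pos.ne'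
  have hper := thetaCusp_periodic_comp_ofComplex_of_dvd γ₀ hM h64 hM0 hN
  have hhol := mdifferentiable_thetaCusp γ₀ hModd
  have hbdd := isBoundedAtImInfty_thetaCusp γ₀ hM h64 hM0
  have hNR : (0 : ℝ) < N := by exact_mod_cast hN0
  exact ⟨UpperHalfPlane.analyticAt_cuspFunction_zero hNR hper hhol hbdd,
    fun τ ↦ UpperHalfPlane.hasSum_qExpansion hNR hper hhol hbdd τ⟩

/-! ## §2 The explicit series of `Θ` in `𝕢_N` -/

/-- `G(a, −k; M) = G(a, k; M)` (substitute `r ↦ −r`). [folklore] -/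
theorem quadGaussSum_neg_right {M : ℕ} [NeZero M] (a k : ZMod M) : quadGaussSum M a (-k) = quadGaussSum M a k := by
  rw [quadGaussSum_def, quadGaussSum_def]
  refine Fintype.sum_equiv (Equiv.neg (ZMod M)) _ _ fun r ↦ ?_
  show (ZMod.stdAddChar (a * r ^ 2 + -k * r) : ℂ) = ZMod.stdAddChar (a * (-r) ^ 2 + k * (-r))
  congr 1
  ring

/-- From a `ℤ`-indexed `HasSum` of an EVEN family to the `ℕ`-indexed one with the terms `k ≥ 1` doubled. [folklore] -/
theorem hasSum_nat_of_hasSum_int_even {f : ℤ → ℂ} {m : ℂ} (hf : HasSum f m) (heven : ∀ n : ℕ, f (-(n : ℤ)) = f n) :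
    HasSum (fun n : ℕ ↦ if n = 0 then f 0 else 2 * f n) m := by
  have h1 := hf.nat_add_neg
  have h2 : HasSum (fun n : ℕ ↦ 2 * f n) (m + f 0) := by
    refine h1.congr_fun fun n ↦ ?_
    rw [heven n]; ring
  have h3 := h2.sub (hasSum_ite_eq (0 : ℕ) (f 0))
  have hm : m + f 0 - f 0 = m := by ring
  rw [hm] at h3
  refine h3.congr_fun fun n ↦ ?_
  by_cases h : n = 0
  · subst h; simp only [if_true, Nat.cast_zero]; ring
  · simp only [if_neg h]; ring

/-- `extend ι A 0 0 = A 0` when `ι` is injective with `ι 0 = 0`. [folklore] -/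
theorem extend_apply_zero_of_map_zero {ι : ℕ → ℕ} (hι : Injective ι) (h0 : ι 0 = 0) (A : ℕ → ℂ) :
    Function.extend ι A 0 0 = A 0 := by
  have h := hι.extend_apply A 0 0
  rwa [h0] at h

/-- Reindexing a series supported on the values of an injective `ι : ℕ → ℕ` to a `q`-series in all exponents (`Function.extend`, zero
off the range). [folklore] -/
theorem hasSum_extend_qParam {ι : ℕ → ℕ} (hι : Injective ι) {a : ℕ → ℂ} {q m : ℂ}
    (h : HasSum (fun n : ℕ ↦ a n * q ^ ι n) m) :
    HasSum (fun K : ℕ ↦ Function.extend ι a 0 K * q ^ K) m := by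
  refine (hι.hasSum_iff (f := fun K : ℕ ↦ Function.extend ι a 0 K * q ^ K) ?_).mp ?_
  · intro K hK
    show Function.extend ι a 0 K * q ^ K = 0
    rw [Function.extend_apply' _ _ _ hK, Pi.zero_apply, zero_mul]
  · refine h.congr_fun fun n ↦ ?_
    show Function.extend ι a 0 (ι n) * q ^ ι n = a n * q ^ ι n
    rw [hι.extend_apply]

/-- The term of `shimuraTheta_flippedCusp_mul_inv_csqrt` as a `𝕢_N`-power (`N = 4N₁`): `exp(πi k² X/(2M)) = e(16k²/M)·𝕢_N(z)^{N₁ k²}`.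
[folklore] -/
theorem cexp_thetaTerm_eq_qParam_pow {M : ℕ} (hM : 0 < M) {N N₁ : ℕ} (hN : N = 4 * N₁) (hN₁ : 0 < N₁) (k : ℤ) (z : ℍ) :
    cexp (Real.pi * I * k ^ 2 * (((M : ℂ) * z + 64) / (2 * M))) =
      cexp (32 * Real.pi * I * k ^ 2 / M) * Periodic.qParam (N : ℝ) (z : ℂ) ^ (N₁ * k.natAbs ^ 2) := by
  rw [cexp_thetaTerm_split hM, cexp_pi_I_sq_mul_half_eq_qParam_pow, mul_comm]
  congr 1
  rw [pow_mul]
  congr 1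
  rw [Periodic.qParam, Periodic.qParam, ← Complex.exp_nat_mul, hN]
  congr 1
  have hN₁' : (N₁ : ℂ) ≠ 0 := by exact_mod_cast hN₁.ne'
  push_cast
  field_simp

/-- **THE EXPLICIT `𝕢_N`-SERIES OF `Θ`.** For `γ₀ = [a b; M 64]` (`M` odd), `N = 4N₁`, `N₁ ≥ 1`, and every `z ∈ ℍ`:
`Θ(z) = Σ_K T(K)·𝕢_N(z)^K` with `T = extend (n ↦ N₁n²) A 0`,
`A(n) = (√(iM/4))⁻¹ · (if n = 0 then 1 else 2) · e(16n²/M) · G(a,n;M)`. [cite: Shimura1973HalfIntegral, §1] -/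
theorem hasSum_thetaCusp (γ₀ : SL(2, ℤ)) {M : ℕ} [NeZero M] (hM : (γ₀ 1 0 : ℤ) = M) (h64 : (γ₀ 1 1 : ℤ) = 64)
    {N N₁ : ℕ} (hN : N = 4 * N₁) (hN₁ : 0 < N₁) (z : ℍ) :
    HasSum (fun K : ℕ ↦ Function.extend (fun n : ℕ ↦ N₁ * n ^ 2)
        (fun n : ℕ ↦ (Complex.sqrt (I * M / 4))⁻¹ * ((if n = 0 then 1 else 2) *
          (cexp (32 * Real.pi * I * (n : ℂ) ^ 2 / M) * quadGaussSum M (γ₀ 0 0) n))) 0 K *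
        Periodic.qParam (N : ℝ) (z : ℂ) ^ K)
      (shimuraTheta (γ₀ • z) * (Complex.sqrt (((M : ℂ) * z + 64) / 8))⁻¹) := by
  have hMpos : 0 < M := Nat.pos_of_ne_zero (NeZero.ne M)
  have hX := im_level_mul_add_sixtyfour_pos hMpos z
  -- the `ℤ`-indexed series
  have hsum := (summable_thetaTransform (c := M) (γ₀ 0 0 : ZMod M) (w := (M : ℂ) * z + 64) hX).hasSum
  set f : ℤ → ℂ := fun k ↦ (Complex.sqrt (I * M / 4))⁻¹ *
    (cexp (32 * Real.pi * I * (k : ℂ) ^ 2 / M) * quadGaussSum M (γ₀ 0 0) k * Periodic.qParam (N : ℝ) (z : ℂ) ^ (N₁ * k.natAbs ^ 2))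
    with hfdef
  have hf : HasSum f (shimuraTheta (γ₀ • z) * (Complex.sqrt (((M : ℂ) * z + 64) / 8))⁻¹) := by
    rw [shimuraTheta_flippedCusp_mul_inv_csqrt γ₀ hM h64 z]
    refine (hsum.mul_left _).congr_fun fun k ↦ ?_
    simp only [hfdef]
    rw [cexp_thetaTerm_eq_qParam_pow hMpos hN hN₁ k z]
    ring
  have heven : ∀ n : ℕ, f (-(n : ℤ)) = f n := by
    intro n
    simp only [hfdef]
    push_cast
    rw [quadGaussSum_neg_right]
    simp [Int.natAbs_neg]
  have h2 := hasSum_nat_of_hasSum_int_even hf heven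
  have hι : Injective (fun n : ℕ ↦ N₁ * n ^ 2) := by
    intro a b hab
    have := Nat.eq_of_mul_eq_mul_left hN₁ hab
    exact Nat.pow_left_injective (by norm_num) this
  refine hasSum_extend_qParam hι (h2.congr_fun fun n ↦ ?_)
  simp only [hfdef]
  push_cast
  simp only [Int.natAbs_natCast]
  split_ifs with h0
  · subst h0; simp
  · ring

/-! ## §3 The three Θ-hypotheses of the transport -/

/-- The coefficient function of §2 takes values in `ℤ̄[1/N]` for `2 ∣ N`, `M ∣ N` (`N₁ ≥ 1`). [folklore] -/
theorem thetaCoeff_mem {M N N₁ : ℕ} [NeZero M] (h2N : 2 ∣ N) (hMN : M ∣ N) (hN₁ : 0 < N₁) (a : ℤ) (K : ℕ) :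
    ∃ j : ℕ, IsIntegral ℤ ((N : ℂ) ^ j *
      Function.extend (fun n : ℕ ↦ N₁ * n ^ 2)
        (fun n : ℕ ↦ (Complex.sqrt (I * M / 4))⁻¹ * ((if n = 0 then 1 else 2) *
          (cexp (32 * Real.pi * I * (n : ℂ) ^ 2 / M) * quadGaussSum M a n))) 0 K) := by
  have hι : Injective (fun n : ℕ ↦ N₁ * n ^ 2) := by
    intro x y hxy
    exact Nat.pow_left_injective (by norm_num) (Nat.eq_of_mul_eq_mul_left hN₁ hxy)
  by_cases hK : ∃ n, N₁ * n ^ 2 = K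
  · obtain ⟨n, rfl⟩ := hK
    rw [hι.extend_apply]
    refine exists_isIntegral_pow_mul_mul (csqrt_I_mul_div_four_inv_mem h2N hMN (NeZero.ne M)).1
      (exists_isIntegral_pow_mul_mul ?_ (exists_isIntegral_pow_mul_mul ?_
        (exists_isIntegral_pow_mul_of_isIntegral (isIntegral_quadGaussSum _ _))))
    · by_cases h0 : n = 0
      · rw [if_pos h0]; exact ⟨0, by simpa using isIntegral_one⟩
      · rw [if_neg h0]; exact exists_isIntegral_pow_mul_natCast 2
    · -- `e(16n²/M)` is a root of unity
      refine exists_isIntegral_pow_mul_of_isIntegral ?_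
      have he : cexp (32 * Real.pi * I * (n : ℂ) ^ 2 / M) = (ZMod.stdAddChar (((16 * n ^ 2 : ℕ) : ℤ) : ZMod M) : ℂ) := by
        rw [ZMod.stdAddChar_coe]; congr 1; push_cast; ring
      rw [he]; exact isIntegral_stdAddChar _
  · rw [Function.extend_apply' _ _ _ hK]
    exact ⟨0, by simpa using isIntegral_zero⟩

/-- **P4c — THE Θ-SIDE HYPOTHESES OF THE NF-Q TRANSPORT, DISCHARGED.** `γ₀ = [a b; M 64] ∈ SL₂(ℤ)`, `M` odd, `16 ∣ N`, `M ∣ N`; with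
`Θ(z) = θ(γ₀•z)·(√((Mz+64)/8))⁻¹` (the θ-factor of P4b's `slash_flippedCusp_eq_theta_mul_bracket`):
(hΘ) `cuspFunction N Θ` is analytic at `0`; (hΘint) every coefficient of `qExpansion N Θ` lies in `ℤ̄[1/N]`; (hΘ0) its constant coefficient,
`(√(iM/4))⁻¹·G(a;M)`, is a unit of `ℤ̄[1/N]` — the three `Θ`-inputs of w3 g19's `exists_isIntegral_qExpansion_coeff_of_slash_eq_mul` for the
2-adic flipped cusp. [cite: Shimura1973HalfIntegral, §1] [cite: Katz1973, §1.6 Cor. 1.6.2 (the consumer)] -/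
theorem theta_transport_hypotheses (γ₀ : SL(2, ℤ)) {M : ℕ} [NeZero M] (hM : (γ₀ 1 0 : ℤ) = M) (h64 : (γ₀ 1 1 : ℤ) = 64)
    (hModd : Odd M) {N : ℕ} (hN : 16 ∣ N) (hN0 : 0 < N) (hMN : M ∣ N) :
    AnalyticAt ℂ (cuspFunction N (fun z : ℍ ↦ shimuraTheta (γ₀ • z) * (Complex.sqrt (((M : ℂ) * z + 64) / 8))⁻¹)) 0 ∧
    (∀ K : ℕ, ∃ j : ℕ, IsIntegral ℤ ((N : ℂ) ^ j *
      (qExpansion N (fun z : ℍ ↦ shimuraTheta (γ₀ • z) * (Complex.sqrt (((M : ℂ) * z + 64) / 8))⁻¹)).coeff K)) ∧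
    ∃ v : ℂ, (∃ j : ℕ, IsIntegral ℤ ((N : ℂ) ^ j * v)) ∧
      (qExpansion N (fun z : ℍ ↦ shimuraTheta (γ₀ • z) * (Complex.sqrt (((M : ℂ) * z + 64) / 8))⁻¹)).coeff 0 * v = 1 := by
  obtain ⟨N₄, rfl⟩ := hN
  have hN₁ : 0 < 4 * N₄ := by omega
  obtain ⟨han, -⟩ := thetaCusp_analytic_and_hasSum γ₀ hM h64 hModd ⟨N₄, rfl⟩ hN0
  have hNR : (0 : ℝ) < ((16 * N₄ : ℕ) : ℝ) := by exact_mod_cast hN0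
  -- identify the coefficients with the explicit `T`
  have hT := fun K ↦ CuspGlue.qExpansion_coeff_unique_of_hasSum (c := fun K : ℕ ↦ Function.extend (fun n : ℕ ↦ (4 * N₄) * n ^ 2)
      (fun n : ℕ ↦ (Complex.sqrt (I * M / 4))⁻¹ * ((if n = 0 then 1 else 2) *
        (cexp (32 * Real.pi * I * (n : ℂ) ^ 2 / M) * quadGaussSum M (γ₀ 0 0) n))) 0 K) hNR han
      (fun τ ↦ by
        simpa only [smul_eq_mul] using hasSum_thetaCusp γ₀ hM h64 (N := 16 * N₄) (N₁ := 4 * N₄) (by ring) hN₁ τ) K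
  have h2N : 2 ∣ 16 * N₄ := ⟨8 * N₄, by ring⟩
  refine ⟨han, fun K ↦ ?_, ?_⟩
  · rw [← hT K]
    have h := thetaCoeff_mem (M := M) (N₁ := 4 * N₄) h2N hMN hN₁ (γ₀ 0 0) K
    simpa only [Int.cast_natCast] using h
  · -- the constant term: `extend ι A 0 0 = A 0 = (√(iM/4))⁻¹ · G(a;M)`
    have hι : Injective (fun n : ℕ ↦ (4 * N₄) * n ^ 2) := by
      intro a b hab
      exact Nat.pow_left_injective (by norm_num) (Nat.eq_of_mul_eq_mul_left hN₁ hab)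
    have h0 : (qExpansion (16 * N₄ : ℕ) (fun z : ℍ ↦ shimuraTheta (γ₀ • z) * (Complex.sqrt (((M : ℂ) * z + 64) / 8))⁻¹)).coeff 0 =
        (Complex.sqrt (I * M / 4))⁻¹ * quadGaussSum M (γ₀ 0 0) 0 := by
      rw [← hT 0, extend_apply_zero_of_map_zero hι (by simp)]
      simp
    rw [h0]
    -- `γ₀ 0 0` is a unit mod `M` (determinant `64a − bM = 1`), `M` odd, `M ∣ N`
    have hdet : (γ₀ 0 0 : ℤ) * 64 - (γ₀ 0 1 : ℤ) * M = 1 := by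
      have := Matrix.det_fin_two (γ₀ : Matrix (Fin 2) (Fin 2) ℤ)
      rw [Matrix.SpecialLinearGroup.det_coe, hM, h64] at this
      linear_combination -this
    obtain ⟨vG, hvG, hG⟩ := exists_inverse_quadGaussSum_of_det (N := 16 * N₄) hModd hMN hdet
    obtain ⟨vc, hvc, hc⟩ := (csqrt_I_mul_div_four_inv_mem (N := 16 * N₄) h2N hMN (NeZero.ne M)).2
    refine ⟨vc * vG, exists_isIntegral_pow_mul_mul hvc hvG, ?_⟩
    have : ((γ₀ 0 0 : ℤ) : ZMod M) = (((γ₀ 0 0 : ℤ)) : ZMod M) := rfl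
    calc (Complex.sqrt (I * M / 4))⁻¹ * quadGaussSum M (γ₀ 0 0) 0 * (vc * vG)
        = ((Complex.sqrt (I * M / 4))⁻¹ * vc) * (quadGaussSum M (γ₀ 0 0) 0 * vG) := by ring
      _ = 1 := by rw [hc, hG, one_mul]

end Summit.BirchSwinnertonDyer.BirchSwinnertonDyer.Theorems.PrintCFram.FlipRung

end
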